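import Literature.NumberTheory.Automorphic.FuchsianPoincareSeries
import Literature.NumberTheory.Automorphic.FuchsianEisensteinConstantTerm
import Literature.Analysis.FunctionSpaces.BesselKBasset
import HarnessLib

/-!
# The Fourier expansion of the Eisenstein series of a general Fuchsian group at a cusp through Kloosterman sums (Iwaniec, Theorem 3.4)
(Iwaniec, *Spectral Methods of Automorphic Forms*, GSM 53, Theorem 3.4 (3.20)–(3.22), (3.17)–(3.19);
PDF pp. 45–46)

For a GENERAL discrete `Γ ≤ SL₂(ℝ)` (inside `GL₂(ℝ)`) with `-1 ∈ Γ`, two cusps `𝔞 = σ_𝔞∞`, `𝔟 = σ_𝔟∞`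
with width-one scaling matrices, and `Re s > 1`, the Fourier modes of `E_𝔞(σ_𝔟 z, s)` (the tree's
`eisCusp Γ σ_𝔞`) along the horocycle of height `y`:

  `∫₀¹ E_𝔞(σ_𝔟(x + iy), s) e(-nx) dx = δ_𝔞𝔟 δ_{n0} y^s + φ_𝔞𝔟(s) y^{1-s}`                 (`n = 0`),
  `∫₀¹ E_𝔞(σ_𝔟(x + iy), s) e(-nx) dx = φ_𝔞𝔟(n, s) · 2√(|n|y) K_{s-1/2}(2π|n|y) = φ_𝔞𝔟(n,s) W_s(i|n|y)` (`n ≠ 0`),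

with **Iwaniec's Kloosterman-sum formulae (3.21)–(3.22)**
`φ_𝔞𝔟(s) = π^{1/2} Γ(s-1/2)Γ(s)⁻¹ Σ_c c^{-2s} S_𝔞𝔟(0,0;c)` (`scatteringKloosterman`) and
`φ_𝔞𝔟(n,s) = π^s Γ(s)⁻¹ |n|^{s-1} Σ_c c^{-2s} S_𝔞𝔟(n,0;c)` (`eisFourierCoeff`; the tree's `cuspKloosterman`
in the convention of (2.23) as printed — the book's (3.22) `S_𝔞𝔟(0,n;c)` is the transposed convention, see
`FuchsianPoincareSeries.cexp_phase_eq_kloostermanTerm`) — `fourierMode_eisCusp_of_offdiag` (no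
upper-triangular element in `σ_𝔞⁻¹Γσ_𝔟`, e.g. inequivalent cusps, `cuspPairSet_apply_10_ne_zero_of_ne`) and
`fourierMode_eisCusp_self` (`𝔟 = 𝔞`). Consequently **the scattering matrix of the tree
(`eisScattering`, defined abstractly from the constant term, `FuchsianEisensteinConstantTerm`) IS (3.21)**:
`eisScattering_eq_scatteringKloosterman`, for every system of inequivalent cusps. Everything is PROVED
(two definitions, the coefficients (3.21)–(3.22); no fact): the expansion (3.17) of
`FuchsianPoincareSeries.lean` for `E_𝔞 = E_𝔞0(· | y^s)` (`eisCusp_eq_poincare`), Iwaniec's integral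
`I_c(y) = y^s c^{-2s} ∫_ℝ (t²+y²)^{-s} e(-nt) dt` (`poincareModeIntegral_cpow_zero`) and the two
evaluations (3.18)–(3.19) of `BesselKBasset.lean`.

Not here: the absolute convergence of `Σ_c c^{-2s} S_𝔞𝔟(n, 0; c)` for `Re s > 1` as a separate statement
(it enters through the summability proved inside (3.17); the `tsum`s are the genuine sums), meromorphic
continuation, (3.23)–(3.24).

## References
* [Iwaniec2002] H. Iwaniec, *Spectral Methods of Automorphic Forms*, 2nd ed., GSM 53, AMS 2002, Thm 3.4 &
  (3.17)–(3.22), PDF pp. 45–46; §2.4 (2.18), PDF p. 34 (held copy `book:iwaniec2002-spectral-methods-automorphic-forms`).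

Mathlib: `OnePoint.smul_infty_eq_self_iff`, `Complex.cpow_def_of_ne_zero`, `Complex.ofReal_log`,
`Complex.norm_cpow_eq_rpow_re_of_pos`, `tsum_mul_right`. Literature: `poincare`, `poincarePair`, `selbergGen`,
`poincareModeIntegral`, `fourierMode_poincarePair_selbergGen_self/_of_offdiag`, `poincare_sigma_smul`,
`rows_conj_eq_pairRows`, `rowLift_mem_and_row`, `im_sl_smul_eq_rowIm` (`FuchsianPoincareSeries`); `eisCusp`, `eisInfty`,
`eisTerm` (`FuchsianEisensteinSeries`); `eisScattering`, `cuspMeanAt_eisCusp` (`FuchsianEisensteinConstantTerm`);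
`integral_sq_add_sq_cpow_neg(_mul_cexp)` (`BesselKBasset`); `besselK` (`BesselK`).
-/

noncomputable section

namespace Literature.NumberTheory.Automorphic

open Matrix UpperHalfPlane
open scoped MatrixGroups

namespace Fuchsian

variable {Γ : Subgroup (GL (Fin 2) ℝ)}

/-! ## E. Theorem 3.4 for a general group: the Fourier coefficients of `E_𝔞(σ_𝔟 z, s)` through Kloosterman sums -/

section EisensteinFourier

open scoped Pointwise Real
open _root_.MeasureTheory Set Filter
open Literature.Analysis.FunctionSpaces

variable {σa σb : SL(2, ℝ)}

/-- A positive real to a complex power through the logarithm. [folklore] -/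
theorem ofReal_cpow_eq_cexp {x : ℝ} (hx : 0 < x) (w : ℂ) :
    ((x : ℝ) : ℂ) ^ w = Complex.exp (w * (Real.log x : ℂ)) := by
  rw [Complex.cpow_def_of_ne_zero (Complex.ofReal_ne_zero.mpr hx.ne'), ← Complex.ofReal_log hx.le, mul_comm]

/-- `√x` as `exp(½ log x)` (`x > 0`). [folklore] -/
theorem ofReal_sqrt_eq_cexp {x : ℝ} (hx : 0 < x) :
    ((Real.sqrt x : ℝ) : ℂ) = Complex.exp ((1 / 2 : ℂ) * (Real.log x : ℂ)) := by
  rw [Real.sqrt_eq_rpow, Real.rpow_def_of_pos hx, Complex.ofReal_exp]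
  congr 1; push_cast; ring

/-- The generating function `y^s` is continuous on `(0, ∞)`. [folklore] -/
theorem continuousOn_ofReal_cpow (s : ℂ) : ContinuousOn (fun u : ℝ => ((u : ℝ) : ℂ) ^ s) (Ioi 0) :=
  fun u hu => (Complex.continuousAt_ofReal_cpow_const u s (Or.inr (ne_of_gt hu))).continuousWithinAt

/-- `|y^s| = y^{Re s} ≤ 1 · y^{Re s}`. [folklore] -/
theorem norm_ofReal_cpow_le (s : ℂ) (u : ℝ) (hu : 0 < u) : ‖((u : ℝ) : ℂ) ^ s‖ ≤ 1 * u ^ s.re := by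
  rw [Complex.norm_cpow_eq_rpow_re_of_pos hu, one_mul]

/-- **`E_𝔞(z, s)` is the Poincaré series of `p(z) = y^s`** (`m = 0`): the tree's `eisCusp` (a sum of
`(Im)^s` over the rows) equals `poincare σ_𝔞 (selbergGen (·^s) 0)` (for `Γ ≤ SL₂(ℝ)`).
[cite: Iwaniec2002, §3.2 (3.10)–(3.11), PDF pp. 42–43] -/
theorem eisCusp_eq_poincare
    (hΓ : Γ ≤ (Matrix.SpecialLinearGroup.toGL : SL(2, ℝ) →* GL (Fin 2) ℝ).range) (σ : SL(2, ℝ)) (z : ℍ) (s : ℂ) :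
    eisCusp Γ σ z s = poincare Γ σ (selbergGen (fun u : ℝ => ((u : ℝ) : ℂ) ^ s) 0) z := by
  unfold eisCusp eisInfty poincare poincarePair
  congr 1
  rw [tsum_congr_set_coe (fun r => eisTerm s r (σ⁻¹ • z)) (rows_conj_eq_pairRows hΓ σ)]
  refine tsum_congr fun r => ?_
  have hl := rowLift_mem_and_row r.2
  unfold eisTerm selbergGen
  simp only [Int.cast_zero, mul_zero, zero_mul, Complex.exp_zero, mul_one]
  rw [im_sl_smul_eq_rowIm, hl.2]

/-- **Iwaniec's integral for `ψ = y^s`, `m = 0`**: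
`I_c(y) = ∫_ℝ (y/(c²(t²+y²)))^s e(-nt) dt = y^s c^{-2s} ∫_ℝ (t²+y²)^{-s} e(-nt) dt`. [cite: Iwaniec2002, §3.4 (between (3.17) and (3.18)), PDF p. 46] -/
theorem poincareModeIntegral_cpow_zero {y c : ℝ} (hy : 0 < y) (hc : 0 < c) (s : ℂ) (n : ℤ) :
    poincareModeIntegral (fun u : ℝ => ((u : ℝ) : ℂ) ^ s) 0 n c y =
      ((y : ℝ) : ℂ) ^ s * ((c : ℝ) : ℂ) ^ (-(2 * s)) *
        ∫ t : ℝ, ((t ^ 2 + y ^ 2 : ℝ) : ℂ) ^ (-s) * Complex.exp (-(2 * π * Complex.I * n * t)) := by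
  unfold poincareModeIntegral
  rw [← integral_const_mul]
  refine integral_congr_ae (Eventually.of_forall fun t => ?_)
  simp only [Int.cast_zero, mul_zero, zero_div, neg_zero, Complex.exp_zero, mul_one]
  have hr : 0 < t ^ 2 + y ^ 2 := by positivity
  have e : (((y / (c ^ 2 * (t ^ 2 + y ^ 2)) : ℝ) : ℂ)) ^ s =
      ((y : ℝ) : ℂ) ^ s * ((c : ℝ) : ℂ) ^ (-(2 * s)) * ((t ^ 2 + y ^ 2 : ℝ) : ℂ) ^ (-s) := by
    rw [ofReal_cpow_eq_cexp (by positivity), ofReal_cpow_eq_cexp hy, ofReal_cpow_eq_cexp hc,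
      ofReal_cpow_eq_cexp hr, ← Complex.exp_add, ← Complex.exp_add]
    congr 1
    rw [Real.log_div hy.ne' (by positivity), Real.log_mul (by positivity) hr.ne', Real.log_pow]
    push_cast
    ring
  rw [e]
  ring

/-- `(y²)^{-(s - 1/2)} y^s = y^{1-s}` for `y > 0`. [folklore] -/
theorem cpow_sq_neg_mul_cpow {y : ℝ} (hy : 0 < y) (s : ℂ) :
    ((y ^ 2 : ℝ) : ℂ) ^ (-(s - 1 / 2)) * ((y : ℝ) : ℂ) ^ s = ((y : ℝ) : ℂ) ^ (1 - s) := by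
  rw [ofReal_cpow_eq_cexp (by positivity), ofReal_cpow_eq_cexp hy, ofReal_cpow_eq_cexp hy, ← Complex.exp_add,
    Real.log_pow]
  congr 1
  push_cast
  ring

variable (Γ) in
/-- **The scattering coefficient through Kloosterman sums** (Iwaniec (3.21)):
`φ_𝔞𝔟(s) = π^{1/2} Γ(s - 1/2) Γ(s)⁻¹ Σ_{c ∈ 𝒞_𝔞𝔟} c^{-2s} S_𝔞𝔟(0, 0; c)`.
[cite: Iwaniec2002, Thm 3.4 (3.21), PDF p. 46] -/
def scatteringKloosterman (σa σb : SL(2, ℝ)) (s : ℂ) : ℂ :=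
  ((Real.sqrt π : ℝ) : ℂ) * Complex.Gamma (s - 1 / 2) / Complex.Gamma s *
    ∑' c : kloostermanModuli Γ σa σb, ((c.1 : ℝ) : ℂ) ^ (-(2 * s)) * cuspKloosterman Γ σa σb 0 0 c.1

variable (Γ) in
/-- **The higher Fourier coefficients through Kloosterman sums** (Iwaniec (3.22)):
`φ_𝔞𝔟(n, s) = π^s Γ(s)⁻¹ |n|^{s-1} Σ_{c ∈ 𝒞_𝔞𝔟} c^{-2s} S_𝔞𝔟(n, 0; c)` — with the tree's
`cuspKloosterman σ_𝔞 σ_𝔟 n 0 c = Σ_d e(nd/c)` ((2.23) as printed gives `S_𝔞𝔟(0, n; c) = Σ e(na/c)`;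
the book's (3.22) uses the transposed convention, see `cexp_phase_eq_kloostermanTerm`).
[cite: Iwaniec2002, Thm 3.4 (3.22), PDF p. 46] -/
def eisFourierCoeff (σa σb : SL(2, ℝ)) (s : ℂ) (n : ℤ) : ℂ :=
  (π : ℂ) ^ s * ((|(n : ℝ)| : ℝ) : ℂ) ^ (s - 1) / Complex.Gamma s *
    ∑' c : kloostermanModuli Γ σa σb, ((c.1 : ℝ) : ℂ) ^ (-(2 * s)) * cuspKloosterman Γ σa σb n 0 c.1

/-- **The sum over the moduli, evaluated**, `n ≠ 0`:
`Σ_c S_𝔞𝔟(n,0;c) I_c(y) = φ_𝔞𝔟(n, s) · 2√(|n|y) K_{s-1/2}(2π|n|y)`. [cite: Iwaniec2002, (3.17), (3.19), (3.22), PDF p. 46] -/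
theorem tsum_cuspKloosterman_mul_modeIntegral_ne_zero {y : ℝ} (hy : 0 < y) {s : ℂ} (hs : 1 / 2 < s.re)
    {n : ℤ} (hn : n ≠ 0) :
    ∑' c : kloostermanModuli Γ σa σb, cuspKloosterman Γ σa σb n 0 c.1 *
        poincareModeIntegral (fun u : ℝ => ((u : ℝ) : ℂ) ^ s) 0 n c.1 y =
      eisFourierCoeff Γ σa σb s n *
        (2 * ((Real.sqrt (|(n : ℝ)| * y) : ℝ) : ℂ) * besselK (s - 1 / 2) ((2 * π * |(n : ℝ)| * y : ℝ) : ℂ)) := by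
  have hn' : (n : ℝ) ≠ 0 := Int.cast_ne_zero.mpr hn
  have hna : 0 < |(n : ℝ)| := abs_pos.mpr hn'
  have hs0 : 0 < s.re := by linarith
  have hΓ : Complex.Gamma s ≠ 0 := Complex.Gamma_ne_zero_of_re_pos hs0
  have hI : ∀ c : kloostermanModuli Γ σa σb, poincareModeIntegral (fun u : ℝ => ((u : ℝ) : ℂ) ^ s) 0 n c.1 y =
      ((c.1 : ℝ) : ℂ) ^ (-(2 * s)) * (((y : ℝ) : ℂ) ^ s * (2 * ((Real.sqrt π : ℝ) : ℂ) *
        ((π * |(n : ℝ)| / y : ℝ) : ℂ) ^ (s - 1 / 2) * besselK (s - 1 / 2) ((2 * π * |(n : ℝ)| * y : ℝ) : ℂ) /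
          Complex.Gamma s)) := by
    intro c
    rw [poincareModeIntegral_cpow_zero hy c.2.1 s n]
    simp_rw [← Complex.ofReal_intCast n]
    rw [integral_sq_add_sq_cpow_neg_mul_cexp hy hn' hs]
    ring
  simp_rw [hI]
  rw [show (fun c : kloostermanModuli Γ σa σb => cuspKloosterman Γ σa σb n 0 c.1 *
      (((c.1 : ℝ) : ℂ) ^ (-(2 * s)) * (((y : ℝ) : ℂ) ^ s * (2 * ((Real.sqrt π : ℝ) : ℂ) *
        ((π * |(n : ℝ)| / y : ℝ) : ℂ) ^ (s - 1 / 2) * besselK (s - 1 / 2) ((2 * π * |(n : ℝ)| * y : ℝ) : ℂ) /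
          Complex.Gamma s)))) =
      fun c : kloostermanModuli Γ σa σb => (((c.1 : ℝ) : ℂ) ^ (-(2 * s)) * cuspKloosterman Γ σa σb n 0 c.1) *
        (((y : ℝ) : ℂ) ^ s * (2 * ((Real.sqrt π : ℝ) : ℂ) *
          ((π * |(n : ℝ)| / y : ℝ) : ℂ) ^ (s - 1 / 2) * besselK (s - 1 / 2) ((2 * π * |(n : ℝ)| * y : ℝ) : ℂ) /
            Complex.Gamma s)) from funext fun c => by ring,
    tsum_mul_right, eisFourierCoeff]
  -- the algebra of positive real powers: `y^s √π (π|n|/y)^{s-1/2} = π^s |n|^{s-1} √(|n|y)`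
  have key : ((y : ℝ) : ℂ) ^ s * (((Real.sqrt π : ℝ) : ℂ) * ((π * |(n : ℝ)| / y : ℝ) : ℂ) ^ (s - 1 / 2)) =
      (π : ℂ) ^ s * ((|(n : ℝ)| : ℝ) : ℂ) ^ (s - 1) * ((Real.sqrt (|(n : ℝ)| * y) : ℝ) : ℂ) := by
    rw [ofReal_cpow_eq_cexp hy, ofReal_sqrt_eq_cexp Real.pi_pos, ofReal_cpow_eq_cexp (by positivity),
      show (π : ℂ) = ((π : ℝ) : ℂ) from rfl, ofReal_cpow_eq_cexp Real.pi_pos, ofReal_cpow_eq_cexp hna,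
      ofReal_sqrt_eq_cexp (by positivity), ← Complex.exp_add, ← Complex.exp_add, ← Complex.exp_add, ← Complex.exp_add]
    congr 1
    rw [Real.log_div (by positivity) hy.ne', Real.log_mul Real.pi_pos.ne' hna.ne', Real.log_mul hna.ne' hy.ne']
    push_cast
    ring
  calc (∑' c : kloostermanModuli Γ σa σb, ((c.1 : ℝ) : ℂ) ^ (-(2 * s)) * cuspKloosterman Γ σa σb n 0 c.1) *
        (((y : ℝ) : ℂ) ^ s * (2 * ((Real.sqrt π : ℝ) : ℂ) *
          ((π * |(n : ℝ)| / y : ℝ) : ℂ) ^ (s - 1 / 2) * besselK (s - 1 / 2) ((2 * π * |(n : ℝ)| * y : ℝ) : ℂ) /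
            Complex.Gamma s))
      = (∑' c : kloostermanModuli Γ σa σb, ((c.1 : ℝ) : ℂ) ^ (-(2 * s)) * cuspKloosterman Γ σa σb n 0 c.1) *
          (2 * (((y : ℝ) : ℂ) ^ s * (((Real.sqrt π : ℝ) : ℂ) * ((π * |(n : ℝ)| / y : ℝ) : ℂ) ^ (s - 1 / 2))) *
            besselK (s - 1 / 2) ((2 * π * |(n : ℝ)| * y : ℝ) : ℂ) / Complex.Gamma s) := by ring
    _ = _ := by rw [key]; field_simp

/-- **The sum over the moduli, evaluated**, `n = 0`: `Σ_c S_𝔞𝔟(0,0;c) I_c(y) = φ_𝔞𝔟(s) y^{1-s}`. [cite: Iwaniec2002, (3.17), (3.18), (3.21), PDF p. 46] -/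
theorem tsum_cuspKloosterman_mul_modeIntegral_zero {y : ℝ} (hy : 0 < y) {s : ℂ} (hs : 1 / 2 < s.re) :
    ∑' c : kloostermanModuli Γ σa σb, cuspKloosterman Γ σa σb 0 0 c.1 *
        poincareModeIntegral (fun u : ℝ => ((u : ℝ) : ℂ) ^ s) 0 0 c.1 y =
      scatteringKloosterman Γ σa σb s * ((y : ℝ) : ℂ) ^ (1 - s) := by
  have hI : ∀ c : kloostermanModuli Γ σa σb, poincareModeIntegral (fun u : ℝ => ((u : ℝ) : ℂ) ^ s) 0 0 c.1 y =
      ((c.1 : ℝ) : ℂ) ^ (-(2 * s)) * (((y : ℝ) : ℂ) ^ s *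
        (((Real.sqrt π : ℝ) : ℂ) * Complex.Gamma (s - 1 / 2) * ((y ^ 2 : ℝ) : ℂ) ^ (-(s - 1 / 2)) / Complex.Gamma s)) := by
    intro c
    rw [poincareModeIntegral_cpow_zero hy c.2.1 s 0]
    simp only [Int.cast_zero, mul_zero, zero_mul, neg_zero, Complex.exp_zero, mul_one]
    rw [integral_sq_add_sq_cpow_neg hy hs]
    ring
  simp_rw [hI]
  rw [show (fun c : kloostermanModuli Γ σa σb => cuspKloosterman Γ σa σb 0 0 c.1 *
      (((c.1 : ℝ) : ℂ) ^ (-(2 * s)) * (((y : ℝ) : ℂ) ^ s *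
        (((Real.sqrt π : ℝ) : ℂ) * Complex.Gamma (s - 1 / 2) * ((y ^ 2 : ℝ) : ℂ) ^ (-(s - 1 / 2)) / Complex.Gamma s)))) =
      fun c : kloostermanModuli Γ σa σb => (((c.1 : ℝ) : ℂ) ^ (-(2 * s)) * cuspKloosterman Γ σa σb 0 0 c.1) *
        (((y : ℝ) : ℂ) ^ s *
          (((Real.sqrt π : ℝ) : ℂ) * Complex.Gamma (s - 1 / 2) * ((y ^ 2 : ℝ) : ℂ) ^ (-(s - 1 / 2)) / Complex.Gamma s))
      from funext fun c => by ring,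
    tsum_mul_right, scatteringKloosterman, ← cpow_sq_neg_mul_cpow hy s]
  ring

/-- **No upper-triangular element in `σ_𝔞⁻¹Γσ_𝔟` for inequivalent cusps of a cusp system**
(`ω ∞ = ∞` would give `γ𝔟 = 𝔞` for `γ = σ_𝔞 ω σ_𝔟⁻¹ ∈ Γ`). [cite: Iwaniec2002, §2.4 (2.18) ("`Ω_∞` … is not empty if and only if `𝔞 = 𝔟`"), PDF p. 34] -/
theorem cuspPairSet_apply_10_ne_zero_of_ne {h : ℕ} {𝔞 : Fin h → OnePoint ℝ} {σ : Fin h → SL(2, ℝ)}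
    (hinfty : ∀ i, (Matrix.SpecialLinearGroup.toGL (σ i) : GL (Fin 2) ℝ) • (OnePoint.infty : OnePoint ℝ) = 𝔞 i)
    (hineq : ∀ i j, ∀ γ ∈ Γ, γ • 𝔞 i = 𝔞 j → i = j) {i j : Fin h} (hij : i ≠ j) :
    ∀ ω ∈ cuspPairSet Γ (σ i) (σ j), ω 1 0 ≠ 0 := by
  intro ω hω h0
  apply hij
  symm
  refine hineq j i _ hω ?_
  have hfix : (Matrix.SpecialLinearGroup.toGL ω : GL (Fin 2) ℝ) • (OnePoint.infty : OnePoint ℝ) = OnePoint.infty := by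
    rw [OnePoint.smul_infty_eq_self_iff]; exact h0
  rw [← hinfty j, ← hinfty i, ← mul_smul, map_mul, map_mul, map_inv, inv_mul_cancel_right, mul_smul, hfix]

/-- **Theorem 3.4 (Iwaniec) for a cusp pair without upper-triangular elements — the Fourier modes
of `E_𝔞(σ_𝔟 z, s)` along the horocycle of height `y`**: for `Re s > 1`, `y > 0`,
`∫₀¹ E_𝔞(σ_𝔟(x+iy), s) e(-nx) dx = φ_𝔞𝔟(s) y^{1-s}` (`n = 0`) and
`= φ_𝔞𝔟(n, s) · 2√(|n|y) K_{s-1/2}(2π|n|y)` (`n ≠ 0`; `= φ_𝔞𝔟(n,s) W_s(i|n|y)`), with the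
Kloosterman-sum coefficients (3.21)–(3.22) (`scatteringKloosterman`, `eisFourierCoeff`).
[cite: Iwaniec2002, Thm 3.4 (3.20)–(3.22), PDF pp. 45–46] -/
theorem fourierMode_eisCusp_of_offdiag
    (hΓ : Γ ≤ (Matrix.SpecialLinearGroup.toGL : SL(2, ℝ) →* GL (Fin 2) ℝ).range)
    (hd : IsDiscreteSubgroup Γ) (hneg : (-1 : GL (Fin 2) ℝ) ∈ Γ)
    (hper : (ConjAct.toConjAct (Matrix.SpecialLinearGroup.toGL σa : GL (Fin 2) ℝ)⁻¹ • Γ).strictPeriods =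
      AddSubgroup.zmultiples (1 : ℝ))
    (hTb : translSL 1 ∈ cuspPairSet Γ σb σb) (h0 : ∀ ω ∈ cuspPairSet Γ σa σb, ω 1 0 ≠ 0)
    {s : ℂ} (hs : 1 < s.re) (n : ℤ) {y : ℝ} (hy : 0 < y) :
    ∫ x in (0 : ℝ)..1, eisCusp Γ σa (σb • ((x : ℝ) +ᵥ UpperHalfPlane.ofComplex ⟨0, y⟩)) s *
        Complex.exp (-(2 * π * Complex.I * n * x)) =
      if n = 0 then scatteringKloosterman Γ σa σb s * ((y : ℝ) : ℂ) ^ (1 - s)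
      else eisFourierCoeff Γ σa σb s n *
        (2 * ((Real.sqrt (|(n : ℝ)| * y) : ℝ) : ℂ) * besselK (s - 1 / 2) ((2 * π * |(n : ℝ)| * y : ℝ) : ℂ)) := by
  have hs' : 1 / 2 < s.re := by linarith
  have e : ∀ x : ℝ, eisCusp Γ σa (σb • ((x : ℝ) +ᵥ UpperHalfPlane.ofComplex ⟨0, y⟩)) s =
      poincarePair Γ σa σb (selbergGen (fun u : ℝ => ((u : ℝ) : ℂ) ^ s) 0) ((x : ℝ) +ᵥ UpperHalfPlane.ofComplex ⟨0, y⟩) := by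
    intro x
    rw [eisCusp_eq_poincare hΓ, poincare_sigma_smul hΓ hd hneg hper (selbergGen_vadd_one _ 0)]
  simp_rw [e]
  rw [fourierMode_poincarePair_selbergGen_of_offdiag hΓ hd hneg hper hTb h0 (continuousOn_ofReal_cpow s) hs
    (norm_ofReal_cpow_le s) le_rfl n hy]
  split_ifs with hn
  · subst hn
    exact tsum_cuspKloosterman_mul_modeIntegral_zero hy hs'
  · exact tsum_cuspKloosterman_mul_modeIntegral_ne_zero hy hs' hn

/-- **Theorem 3.4 (Iwaniec) at the cusp `𝔞` itself**: for `Re s > 1`, `y > 0`,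
`∫₀¹ E_𝔞(σ_𝔞(x+iy), s) e(-nx) dx = δ_{n0} y^s + [φ_𝔞𝔞(s) y^{1-s} | φ_𝔞𝔞(n,s) 2√(|n|y)K_{s-1/2}(2π|n|y)]`.
[cite: Iwaniec2002, Thm 3.4 (3.20)–(3.22), PDF pp. 45–46] -/
theorem fourierMode_eisCusp_self
    (hΓ : Γ ≤ (Matrix.SpecialLinearGroup.toGL : SL(2, ℝ) →* GL (Fin 2) ℝ).range)
    (hd : IsDiscreteSubgroup Γ) (hneg : (-1 : GL (Fin 2) ℝ) ∈ Γ)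
    (hper : (ConjAct.toConjAct (Matrix.SpecialLinearGroup.toGL σa : GL (Fin 2) ℝ)⁻¹ • Γ).strictPeriods =
      AddSubgroup.zmultiples (1 : ℝ))
    {s : ℂ} (hs : 1 < s.re) (n : ℤ) {y : ℝ} (hy : 0 < y) :
    ∫ x in (0 : ℝ)..1, eisCusp Γ σa (σa • ((x : ℝ) +ᵥ UpperHalfPlane.ofComplex ⟨0, y⟩)) s *
        Complex.exp (-(2 * π * Complex.I * n * x)) =
      (if n = 0 then ((y : ℝ) : ℂ) ^ s else 0) +
        (if n = 0 then scatteringKloosterman Γ σa σa s * ((y : ℝ) : ℂ) ^ (1 - s)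
         else eisFourierCoeff Γ σa σa s n *
          (2 * ((Real.sqrt (|(n : ℝ)| * y) : ℝ) : ℂ) * besselK (s - 1 / 2) ((2 * π * |(n : ℝ)| * y : ℝ) : ℂ))) := by
  have hs' : 1 / 2 < s.re := by linarith
  have e : ∀ x : ℝ, eisCusp Γ σa (σa • ((x : ℝ) +ᵥ UpperHalfPlane.ofComplex ⟨0, y⟩)) s =
      poincarePair Γ σa σa (selbergGen (fun u : ℝ => ((u : ℝ) : ℂ) ^ s) 0) ((x : ℝ) +ᵥ UpperHalfPlane.ofComplex ⟨0, y⟩) := by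
    intro x
    rw [eisCusp_eq_poincare hΓ, poincare_sigma_smul hΓ hd hneg hper (selbergGen_vadd_one _ 0)]
  simp_rw [e]
  rw [fourierMode_poincarePair_selbergGen_self hΓ hd hneg hper (continuousOn_ofReal_cpow s) hs
    (norm_ofReal_cpow_le s) le_rfl n hy]
  congr 1
  · split_ifs with hn
    · subst hn; simp
    · rfl
  · split_ifs with hn
    · subst hn
      exact tsum_cuspKloosterman_mul_modeIntegral_zero hy hs'
    · exact tsum_cuspKloosterman_mul_modeIntegral_ne_zero hy hs' hn

/-- **The scattering matrix of the tree is given by the Kloosterman sums** (Iwaniec (3.21)): for a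
system of inequivalent cusps `𝔞ᵢ = σᵢ∞` with width-one scaling matrices (`-1 ∈ Γ`) and `Re s > 1`,
`φᵢⱼ(s) = eisScattering Γ σ i j s = π^{1/2} Γ(s-1/2) Γ(s)⁻¹ Σ_{c ∈ 𝒞_{𝔞ᵢ𝔞ⱼ}} c^{-2s} S_{𝔞ᵢ𝔞ⱼ}(0, 0; c)`
(the constant terms `δᵢⱼ y^s + φᵢⱼ(s) y^{1-s}` of `cuspMeanAt_eisCusp` and of `fourierMode_eisCusp_*`
agree; read off at `y = 1`). [cite: Iwaniec2002, Thm 3.4 (3.20)–(3.21), PDF pp. 45–46] -/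
theorem eisScattering_eq_scatteringKloosterman {h : ℕ} {𝔞 : Fin h → OnePoint ℝ} {σ : Fin h → SL(2, ℝ)}
    (hΓ : Γ ≤ (Matrix.SpecialLinearGroup.toGL : SL(2, ℝ) →* GL (Fin 2) ℝ).range)
    (hneg : (-1 : GL (Fin 2) ℝ) ∈ Γ) (hd : IsDiscreteSubgroup Γ)
    (hinfty : ∀ i, (Matrix.SpecialLinearGroup.toGL (σ i) : GL (Fin 2) ℝ) • (OnePoint.infty : OnePoint ℝ) = 𝔞 i)
    (hper : ∀ i, (ConjAct.toConjAct (Matrix.SpecialLinearGroup.toGL (σ i) : GL (Fin 2) ℝ)⁻¹ • Γ).strictPeriods =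
      AddSubgroup.zmultiples 1)
    (hineq : ∀ i j, ∀ γ ∈ Γ, γ • 𝔞 i = 𝔞 j → i = j)
    {s : ℂ} (hs : 1 < s.re) (i j : Fin h) :
    eisScattering Γ σ i j s = scatteringKloosterman Γ (σ i) (σ j) s := by
  have h1 := cuspMeanAt_eisCusp hΓ hneg hd hinfty hper hineq hs i j one_pos
  rw [cuspMeanAt_apply] at h1
  have hmode : (∫ ξ in (0 : ℝ)..1, eisCusp Γ (σ i) (σ j • ((ξ : ℝ) +ᵥ UpperHalfPlane.ofComplex ⟨0, 1⟩)) s) =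
      ∫ ξ in (0 : ℝ)..1, eisCusp Γ (σ i) (σ j • ((ξ : ℝ) +ᵥ UpperHalfPlane.ofComplex ⟨0, 1⟩)) s *
        Complex.exp (-(2 * π * Complex.I * ((0 : ℤ) : ℂ) * ξ)) := by
    refine intervalIntegral.integral_congr fun ξ _ => ?_
    simp
  have hTj : translSL 1 ∈ cuspPairSet Γ (σ j) (σ j) := by
    rw [← toGL_mem_conj_iff_mem_cuspPairSet, toGL_translSL, ← Subgroup.mem_strictPeriods_iff, hper j]
    exact AddSubgroup.mem_zmultiples 1
  by_cases hij : i = j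
  · subst hij
    rw [hmode, fourierMode_eisCusp_self hΓ hd hneg (hper i) hs 0 one_pos] at h1
    simp only [↓reduceIte, Complex.ofReal_one, Complex.one_cpow, mul_one] at h1
    exact (add_left_cancel h1).symm
  · rw [hmode, fourierMode_eisCusp_of_offdiag hΓ hd hneg (hper i) hTj
      (cuspPairSet_apply_10_ne_zero_of_ne hinfty hineq hij) hs 0 one_pos] at h1
    simp only [↓reduceIte, Complex.ofReal_one, Complex.one_cpow, mul_one, hij, zero_add] at h1
    exact h1.symm

end EisensteinFourier

end Fuchsian

end Literature.NumberTheory.Automorphic
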